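import Literature.MathematicalPhysics.QuantumLattice.DWaveNodalShellVolume
import Literature.MathematicalPhysics.QuantumLattice.ReducedBCSTorus
import HarnessLib

/-!
# The nodal level count on the discrete torus: `#{k : (ε_L(k)-μ)² + Δ² d(k)² < t²} ≤ C (Lt+1)²/Δ`

Topic `Literature/MathematicalPhysics/QuantumLattice`; the finite-volume companion of
`DWaveNodalShellVolume` (`exists_planarNodalShellVolume_le_twoPi`: on the period square `[0, 2π)²`
the sublevel set `{(ε - μ)² + Δ²d² < t²}` of the `d`-wave BdG band, `ε = -2(cos k₁ + cos k₂)`,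
`d = cos k₁ - cos k₂`, has area `≤ C t²/Δ` for levels `μ` in a compact sub-band of `(-4, 0)` and gaps
`0 < Δ ≤ Δ₀`).

For the momenta `k ∈ (ℤ/Lℤ)²` of the `L × L` torus (`latticeMomentum`, band `torusBand L k`,
`d`-wave form factor `dWaveGap k` of `ReducedBCSTorus`) the number of quasi-momenta of BdG energy
below `t` obeys the same law at the resolution of the grid:

* `sq_add_sq_lt_sq_add` — the planar triangle inequality in the form used on a grid cell;
* `disjoint_Ico_grid` — distinct cells `[ca, ca + c)` of a grid of mesh `c` are disjoint;
* `exists_card_nodalShell_le` — **`#{k ∈ (ℤ/Lℤ)² : (ε_L(k) - μ)² + Δ² d(k)² < t²} ≤ C (L t + 1)²/Δ`**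
  for all `μ ∈ [μ₁, μ₂]`, `0 < Δ ≤ Δ₀`, `t > 0` and EVERY side `L ≥ 1`, with `C = C(μ₁, μ₂, Δ₀)`.
  Proof (cell packing): the half-open cells `p(k) + [0, 2π/L)²` of the counted momenta are pairwise
  disjoint, tile into `[0, 2π)²`, and — the BdG energy being `(4 + 2Δ)`-Lipschitz for the sup-metric —
  lie in the planar sublevel set at the enlarged level `t + (4 + 2Δ₀)·2π/L`; compare areas.

So at fixed `t` the count is `O(L² t²/Δ)` once `L t ≥ 1` (the continuum nodal density of states),
and `O(1/Δ)`-many momenta sit below any level `t ≲ 1/L`. This is the form in which the nodal phase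
space enters finite-volume (torus) estimates that are uniform in `L`. Everything is proved; no
definitions. [folklore]

## Sources

Folklore; lattice-point counting by cell packing as in S. Friedli, Y. Velenik, *Statistical Mechanics
of Lattice Systems* (2017), §B (momentum grid §10.4); nodal `d`-wave phase space: A. C. Durst,
P. A. Lee, Phys. Rev. B 62 (2000) 1270, §II.

## Mathlib / tree search

`lean search "card_torusShell|nodalShell|dWaveGap"` — `TorusShellCountUniform.card_torusShell_le_sqrt`
(`#{|ε - μ| ≤ η} ≤ √η L² + 2L`, no gap, `√`-modulus), `DWaveGapLatticeCount` (non-nodal fraction of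
the zone); the nodal count is new.
-/

noncomputable section

open Real Set MeasureTheory MeasureTheory.Measure
open scoped ENNReal
open Literature.Probability.LatticeModels

namespace Literature.MathematicalPhysics.QuantumLattice

/-! ### Two elementary lemmas -/

/-- If `a² + b² < t²` (`t > 0`), `|a'| ≤ |a| + ε₁` and `|b'| ≤ |b| + ε₂` (`εᵢ ≥ 0`), then
`a'² + b'² < (t + ε₁ + ε₂)²` (triangle inequality for the Euclidean norm of the plane). [folklore] -/
theorem sq_add_sq_lt_sq_add {a b a' b' t ε₁ ε₂ : ℝ} (ht : 0 < t) (h : a ^ 2 + b ^ 2 < t ^ 2)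
    (ha : |a'| ≤ |a| + ε₁) (hb : |b'| ≤ |b| + ε₂) (hε₁ : 0 ≤ ε₁) (hε₂ : 0 ≤ ε₂) :
    a' ^ 2 + b' ^ 2 < (t + ε₁ + ε₂) ^ 2 := by
  set s : ℝ := Real.sqrt (a ^ 2 + b ^ 2) with hs
  have hs0 : 0 ≤ s := Real.sqrt_nonneg _
  have hs2 : s ^ 2 = a ^ 2 + b ^ 2 := Real.sq_sqrt (by positivity)
  have has : |a| ≤ s := Real.abs_le_sqrt (by nlinarith [sq_nonneg b])
  have hbs : |b| ≤ s := Real.abs_le_sqrt (by nlinarith [sq_nonneg a])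
  have hst : s < t := by rw [hs, Real.sqrt_lt' ht]; exact h
  have h1 : a' ^ 2 ≤ (|a| + ε₁) ^ 2 := by
    rw [← sq_abs a']; exact pow_le_pow_left₀ (abs_nonneg _) ha 2
  have h2 : b' ^ 2 ≤ (|b| + ε₂) ^ 2 := by
    rw [← sq_abs b']; exact pow_le_pow_left₀ (abs_nonneg _) hb 2
  have h3 : (|a| + ε₁) ^ 2 + (|b| + ε₂) ^ 2 ≤ (s + ε₁ + ε₂) ^ 2 := by
    have e1 : |a| ^ 2 + |b| ^ 2 = s ^ 2 := by rw [sq_abs, sq_abs, hs2]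
    nlinarith [mul_le_mul_of_nonneg_right has hε₁, mul_le_mul_of_nonneg_right hbs hε₂, mul_nonneg hε₁ hε₂]
  have h4 : (s + ε₁ + ε₂) ^ 2 < (t + ε₁ + ε₂) ^ 2 := by nlinarith
  linarith

/-- Distinct cells `[c a, c a + c)` (`a ∈ ℕ`) of a grid of mesh `c > 0` are disjoint. [folklore] -/
theorem disjoint_Ico_grid {c : ℝ} (hc : 0 < c) {a a' : ℕ} (h : a ≠ a') :
    Disjoint (Ico (c * a) (c * a + c)) (Ico (c * a') (c * a' + c)) := by
  rw [Set.Ico_disjoint_Ico]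
  rcases Nat.lt_or_gt_of_ne h with hlt | hlt
  · have h1 : (a : ℝ) + 1 ≤ a' := by exact_mod_cast hlt
    calc min (c * a + c) (c * a' + c) ≤ c * a + c := min_le_left _ _
      _ ≤ c * a' := by nlinarith
      _ ≤ max (c * a) (c * a') := le_max_right _ _
  · have h1 : (a' : ℝ) + 1 ≤ a := by exact_mod_cast hlt
    calc min (c * a + c) (c * a' + c) ≤ c * a' + c := min_le_right _ _
      _ ≤ c * a := by nlinarith
      _ ≤ max (c * a) (c * a') := le_max_left _ _

/-! ### The nodal level count -/

/-- The lattice momentum in grid form: `p_i(k) = (2π/L) · (k i).val`. [folklore] -/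
theorem latticeMomentum_eq_mesh_mul {L : ℕ} (k : TorusSite 2 L) (i : Fin 2) :
    latticeMomentum L k i = 2 * π / L * ((k i).val : ℝ) := by
  simp only [latticeMomentum]
  ring

/-- The torus band in coordinates: `ε_L(k) = -2 (cos p₀(k) + cos p₁(k))`. [folklore] -/
theorem torusBand_two_eq_latticeMomentum {L : ℕ} (k : TorusSite 2 L) :
    torusBand L k = -2 * (Real.cos (latticeMomentum L k 0) + Real.cos (latticeMomentum L k 1)) := by
  simp only [torusBand, Fin.sum_univ_two]

/-- **The nodal level count on the discrete torus.** For a compact sub-band `[μ₁, μ₂] ⊂ (-4, 0)` and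
a cap `Δ₀ > 0` there is `C ≥ 0` such that for all `μ ∈ [μ₁, μ₂]`, `0 < Δ ≤ Δ₀`, `t > 0` and every
side `L ≥ 1`,
`#{k ∈ (ℤ/Lℤ)² : (ε_L(k) - μ)² + (Δ d(k))² < t²} ≤ C (L t + 1)² / Δ`
(`ε_L = torusBand L`, `d = dWaveGap`). [folklore] -/
theorem exists_card_nodalShell_le {μ₁ μ₂ Δ₀ : ℝ} (hμ₁ : -4 < μ₁) (hμ₂ : μ₂ < 0) (hΔ₀ : 0 < Δ₀) :
    ∃ C : ℝ, 0 ≤ C ∧ ∀ μ ∈ Icc μ₁ μ₂, ∀ Δ ∈ Ioc (0 : ℝ) Δ₀, ∀ t : ℝ, 0 < t → ∀ (L : ℕ) [NeZero L],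
      (((Finset.univ.filter fun k : TorusSite 2 L =>
        (torusBand L k - μ) ^ 2 + (Δ * dWaveGap k) ^ 2 < t ^ 2).card : ℕ) : ℝ) ≤
        C * ((L : ℝ) * t + 1) ^ 2 / Δ := by
  have hπ0 : 0 < π := Real.pi_pos
  have hπ2 : (2 : ℝ) ≤ π := Real.two_le_pi
  obtain ⟨C₀, hC₀, hvol⟩ := exists_planarNodalShellVolume_le_twoPi hμ₁ hμ₂ hΔ₀
  set K : ℝ := 4 + 2 * Δ₀ with hK
  have hK4 : 4 ≤ K := by rw [hK]; linarith
  refine ⟨C₀ * K ^ 2, by positivity, fun μ hμ Δ hΔ t ht L _ => ?_⟩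
  have hΔ0 : 0 < Δ := hΔ.1
  have hL : (0 : ℝ) < L := Nat.cast_pos.2 (Nat.pos_of_ne_zero (NeZero.ne L))
  set c : ℝ := 2 * π / L with hc
  have hc0 : 0 < c := by positivity
  have hcL : c * L = 2 * π := by rw [hc]; field_simp
  set t' : ℝ := t + 4 * c + 2 * Δ₀ * c with ht'
  have ht'0 : 0 < t' := by positivity
  -- the counted momenta, their cells, and the enlarged planar sublevel set
  set S : Finset (TorusSite 2 L) := Finset.univ.filter fun k : TorusSite 2 L =>
    (torusBand L k - μ) ^ 2 + (Δ * dWaveGap k) ^ 2 < t ^ 2 with hS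
  set cell : TorusSite 2 L → Set (ℝ × ℝ) := fun k =>
    Ico (c * ((k 0).val : ℝ)) (c * ((k 0).val : ℝ) + c) ×ˢ Ico (c * ((k 1).val : ℝ)) (c * ((k 1).val : ℝ) + c)
    with hcell
  set Q : Set (ℝ × ℝ) := {x : ℝ × ℝ | (x.1 ∈ Ico 0 (2 * π) ∧ x.2 ∈ Ico 0 (2 * π)) ∧
      (-2 * (Real.cos x.1 + Real.cos x.2) - μ) ^ 2 + (Δ * (Real.cos x.1 - Real.cos x.2)) ^ 2 < t' ^ 2}
    with hQ
  have hQvol : volume Q ≤ ENNReal.ofReal (C₀ * t' ^ 2 / Δ) := hvol μ hμ Δ hΔ t' ht'0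
  -- a cell coordinate stays in `[0, 2π)` and within `c` of the grid momentum
  have hcoord : ∀ (k : TorusSite 2 L) (i : Fin 2) (y : ℝ),
      y ∈ Ico (c * ((k i).val : ℝ)) (c * ((k i).val : ℝ) + c) →
        y ∈ Ico 0 (2 * π) ∧ |y - latticeMomentum L k i| ≤ c := by
    intro k i y hy
    have hv0 : (0 : ℝ) ≤ (k i).val := Nat.cast_nonneg _
    have hv1 : ((k i).val : ℝ) + 1 ≤ L := by exact_mod_cast ZMod.val_lt (k i)
    refine ⟨⟨le_trans (by positivity) hy.1, ?_⟩, ?_⟩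
    · calc y < c * ((k i).val : ℝ) + c := hy.2
        _ = c * (((k i).val : ℝ) + 1) := by ring
        _ ≤ c * L := by gcongr
        _ = 2 * π := hcL
    · rw [latticeMomentum_eq_mesh_mul, ← hc]
      rw [abs_le]
      constructor <;> linarith [hy.1, hy.2]
  -- the cells of counted momenta lie in `Q`
  have hsub : ∀ k ∈ S, cell k ⊆ Q := by
    intro k hk x hx
    rw [hS, Finset.mem_filter] at hk
    obtain ⟨-, hk⟩ := hk
    rw [hcell] at hx
    simp only [mem_prod] at hx
    obtain ⟨h0, h0'⟩ := hcoord k 0 x.1 hx.1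
    obtain ⟨h1, h1'⟩ := hcoord k 1 x.2 hx.2
    refine ⟨⟨h0, h1⟩, ?_⟩
    rw [torusBand_two_eq_latticeMomentum] at hk
    simp only [dWaveGap] at hk
    set p₀ := latticeMomentum L k 0
    set p₁ := latticeMomentum L k 1
    have hξ : |-2 * (Real.cos x.1 + Real.cos x.2) - μ| ≤ |-2 * (Real.cos p₀ + Real.cos p₁) - μ| + 4 * c := by
      have e : -2 * (Real.cos x.1 + Real.cos x.2) - μ =
          (-2 * (Real.cos p₀ + Real.cos p₁) - μ) + (-2) * ((Real.cos x.1 - Real.cos p₀) + (Real.cos x.2 - Real.cos p₁)) := by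
        ring
      rw [e]
      refine (abs_add_le _ _).trans ?_
      have h₁ := Real.abs_cos_sub_cos_le x.1 p₀
      have h₂ := Real.abs_cos_sub_cos_le x.2 p₁
      have h₃ : |(-2) * ((Real.cos x.1 - Real.cos p₀) + (Real.cos x.2 - Real.cos p₁))| ≤ 4 * c := by
        rw [abs_mul, abs_neg, abs_two]
        have := abs_add_le (Real.cos x.1 - Real.cos p₀) (Real.cos x.2 - Real.cos p₁)
        linarith
      linarith
    have hd : |Δ * (Real.cos x.1 - Real.cos x.2)| ≤ |Δ * (Real.cos p₀ - Real.cos p₁)| + 2 * Δ₀ * c := by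
      have e : Δ * (Real.cos x.1 - Real.cos x.2) =
          Δ * (Real.cos p₀ - Real.cos p₁) + Δ * ((Real.cos x.1 - Real.cos p₀) - (Real.cos x.2 - Real.cos p₁)) := by
        ring
      rw [e]
      refine (abs_add_le _ _).trans ?_
      have h₁ := Real.abs_cos_sub_cos_le x.1 p₀
      have h₂ := Real.abs_cos_sub_cos_le x.2 p₁
      have h₃ : |Δ * ((Real.cos x.1 - Real.cos p₀) - (Real.cos x.2 - Real.cos p₁))| ≤ 2 * Δ₀ * c := by
        rw [abs_mul, abs_of_pos hΔ0]
        have := abs_sub (Real.cos x.1 - Real.cos p₀) (Real.cos x.2 - Real.cos p₁)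
        have h4 : |(Real.cos x.1 - Real.cos p₀) - (Real.cos x.2 - Real.cos p₁)| ≤ 2 * c := by linarith
        calc Δ * |(Real.cos x.1 - Real.cos p₀) - (Real.cos x.2 - Real.cos p₁)| ≤ Δ₀ * (2 * c) :=
              mul_le_mul hΔ.2 h4 (abs_nonneg _) hΔ₀.le
          _ = 2 * Δ₀ * c := by ring
      linarith
    have := sq_add_sq_lt_sq_add ht hk hξ hd (by positivity) (by positivity)
    rw [ht']
    exact this
  -- the cells are measurable, pairwise disjoint, of area `c²`
  have hmeas : ∀ k ∈ S, MeasurableSet (cell k) := fun k _ => measurableSet_Ico.prod measurableSet_Ico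
  have hdisj : Set.PairwiseDisjoint (↑S : Set (TorusSite 2 L)) cell := by
    intro k _ k' _ hne
    obtain ⟨i, hi⟩ := Function.ne_iff.1 hne
    have hv : (k i).val ≠ (k' i).val := fun h => hi (ZMod.val_injective L h)
    show Disjoint (cell k) (cell k')
    rw [hcell]
    fin_cases i
    · exact Set.disjoint_prod.2 (Or.inl (disjoint_Ico_grid hc0 hv))
    · exact Set.disjoint_prod.2 (Or.inr (disjoint_Ico_grid hc0 hv))
  have hvolcell : ∀ k ∈ S, volume (cell k) = ENNReal.ofReal (c ^ 2) := by
    intro k _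
    rw [hcell]
    simp only
    rw [show (volume : Measure (ℝ × ℝ)) = (volume : Measure ℝ).prod volume from rfl, Measure.prod_prod,
      Real.volume_Ico, Real.volume_Ico, ← ENNReal.ofReal_mul (by linarith)]
    congr 1; ring
  -- packing
  have hpack : ENNReal.ofReal ((S.card : ℝ) * c ^ 2) ≤ ENNReal.ofReal (C₀ * t' ^ 2 / Δ) := by
    calc ENNReal.ofReal ((S.card : ℝ) * c ^ 2) = ∑ k ∈ S, volume (cell k) := by
          rw [Finset.sum_congr rfl hvolcell, Finset.sum_const, nsmul_eq_mul,
            ENNReal.ofReal_mul (Nat.cast_nonneg _), ENNReal.ofReal_natCast]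
      _ = volume (⋃ k ∈ S, cell k) := (measure_biUnion_finset hdisj hmeas).symm
      _ ≤ volume Q := measure_mono (Set.iUnion₂_subset hsub)
      _ ≤ ENNReal.ofReal (C₀ * t' ^ 2 / Δ) := hQvol
  have hreal : (S.card : ℝ) * c ^ 2 ≤ C₀ * t' ^ 2 / Δ :=
    (ENNReal.ofReal_le_ofReal_iff (by positivity)).1 hpack
  -- `t' ≤ K (Lt + 1) c`, and divide by `c²`
  have ht'le : t' ≤ K * ((L : ℝ) * t + 1) * c := by
    have e1 : t' = t + K * c := by rw [ht', hK]; ring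
    have e2 : K * ((L : ℝ) * t) * c = 2 * π * K * t := by
      rw [hc]; field_simp
    have hπK : 8 ≤ π * K := by nlinarith
    have h1 : t ≤ 2 * π * K * t := by nlinarith
    calc t' = t + K * c := e1
      _ ≤ 2 * π * K * t + K * c := by linarith
      _ = K * ((L : ℝ) * t + 1) * c := by rw [← e2]; ring
  have hsq : t' ^ 2 ≤ (K * ((L : ℝ) * t + 1) * c) ^ 2 := pow_le_pow_left₀ ht'0.le ht'le 2
  have hfin : (S.card : ℝ) * c ^ 2 ≤ C₀ * K ^ 2 * ((L : ℝ) * t + 1) ^ 2 / Δ * c ^ 2 := by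
    calc (S.card : ℝ) * c ^ 2 ≤ C₀ * t' ^ 2 / Δ := hreal
      _ ≤ C₀ * (K * ((L : ℝ) * t + 1) * c) ^ 2 / Δ := by gcongr
      _ = C₀ * K ^ 2 * ((L : ℝ) * t + 1) ^ 2 / Δ * c ^ 2 := by ring
  exact le_of_mul_le_mul_right hfin (by positivity)

end Literature.MathematicalPhysics.QuantumLattice

end
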